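import Literature.Analysis.FunctionSpaces.TorusConvectionLaplacianNormSq
import HarnessLib

/-!
# The `H²` norm of the linearised inertial term `(v·∇)w + (w·∇)v` on `T³`

Analysis/FunctionSpaces support file (everything proved; no definitions, no named facts), the BILINEAR
twin of `TorusConvectionLaplacianNormSq.lean` (`‖Δ((u·∇)u)‖₂² ≤ C (‖∇u‖₂² + ‖Δu‖₂²)(‖Δu‖₂² + ‖∇Δu‖₂²)`
for zero-mean `u` on `T³`; the Leibniz rule `∂ₘ((v·∇)w) = (v·∇)∂ₘw + (∂ₘv·∇)w` and the transport /
stretching shapes `‖∇((v·∇)w)‖₂² ≤ 2d M₀² ‖Δw‖₂² + 2d² M₁² ‖∇w‖₂²` / `… + 2d² M₁² ‖∇v‖₂²`). It proves the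
`H²` bound of the production term `(v·∇)w + (w·∇)v` of the linearised Navier–Stokes equation
(Constantin–Foias 1988, Ch. 14, (14.3)) along a base field `v` controlled in `W^{1,∞}` (`‖v‖ ≤ M`,
`‖∂ₖv‖ ≤ L`) and in `H³` (`‖Δv‖₂`, `‖∇Δv‖₂`), with the unknown `w` zero-mean and measured in `H³`:

* `Torus.gradNormSq_partialDeriv_convect_add_convect_le` — in every dimension, for smooth `v, w` with
  `‖v‖ ≤ M`, `‖∂ₖv‖ ≤ L`, `‖w‖ ≤ N₀`, `‖∂ₖw‖ ≤ N₁`, and every direction `m`,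
  `‖∇∂ₘ((v·∇)w + (w·∇)v)‖₂² ≤ 8dM² ‖Δ∂ₘw‖₂² + 16d²L² ‖∇∂ₘw‖₂² + 16d²N₁² ‖∇∂ₘv‖₂² + 8dN₀² ‖Δ∂ₘv‖₂²
    + 8dL² ‖Δw‖₂² + 8dN₁² ‖Δv‖₂²`
  (Leibniz, `∂ₘF = [(v·∇)∂ₘw + (∂ₘv·∇)w] + [(w·∇)∂ₘv + (∂ₘw·∇)v]`, then the two shapes: the sup norms
  always fall on a factor carrying at most one derivative);
* `Torus.integral_norm_laplacian_convect_add_convect_sq_le` — **the estimate**: on `T^d` with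
  `card d = 3` there is `C ≥ 0` with
  `‖Δ((v·∇)w + (w·∇)v)‖₂² ≤ C (M² + L² + ‖Δv‖₂² + ‖∇Δv‖₂²)(‖∇w‖₂² + ‖Δw‖₂² + ‖∇Δw‖₂²)`
  for smooth `v, w` with `∫ w = 0`, `‖v‖ ≤ M`, `‖∂ₖv‖ ≤ L` — the bilinear (polarised) form of
  "`B` maps `D(A^{3/2}) × D(A^{3/2})` into `D(A)`" (Constantin–Foias 1988, Ch. 6; the `H²`-level instance
  of "`H^k(T³)` is an algebra", Robinson–Rodrigo–Sadowski 2016, proof of Thm 7.1, (7.3), `k = 3`), LINEAR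
  in the top-order quantity `‖∇Δw‖₂²` of the unknown: sum the directional bound over `m`
  (`∑ₘ ‖Δ∂ₘ·‖₂² = ‖∇Δ·‖₂²`, `∑ₘ ‖∇∂ₘ·‖₂² = ‖Δ·‖₂²`) with `N₀² = K(‖∇w‖₂² + ‖Δw‖₂²)`
  (`Torus.norm_sq_le_gradNormSq_add_of_hasZeroMean`) and `N₁² = K'(‖Δw‖₂² + ‖∇Δw‖₂²)`
  (`Torus.norm_partialDeriv_sq_le_of_isSmooth`).

Consumed by the flux bound of the `H³` balance of the linearised equation
(`FluidPDE/TorusLinearisedNSH3Balance.lean`) and the `V → D(A^{3/2})` smoothing of the linearised flow.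
Deliberately NOT here: the `H³` level of the bilinear term, `L⁴`-interpolation refinements.

## Mathlib / tree search

Tree (reused): `Torus.partialDeriv_convect_eq_add_convect`, `Torus.gradNormSq_convect_le_of_norm_left_le`,
`Torus.gradNormSq_convect_le_of_norm_right_le`, `Torus.gradNormSq_add_le`,
`Torus.norm_partialDeriv_sq_le_of_isSmooth`, `Torus.gradNormSq_laplacian_eq_sum`
(`TorusConvectionLaplacianNormSq`), `Torus.norm_sq_le_gradNormSq_add_of_hasZeroMean`
(`TorusConvectionGradNormSq`), `Torus.sum_gradNormSq_partialDeriv_eq` (`TorusEnstrophyTrilinear`),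
`Torus.partialDeriv_add` (`TorusTestFunction`); the pattern is
`Torus.integral_norm_laplacian_convect_self_sq_le`. Searched `laplacian (convect` with `+`,
`convect_add_convect`, `linearised.*laplacian.*convect`: only the quadratic bound and the `H¹` shapes; no
bilinear `H²` bound in the tree.

## References

* P. Constantin, C. Foias, *Navier–Stokes Equations*, Univ. Chicago Press 1988, Ch. 6 and Ch. 14,
  (14.3). [ConstantinFoiasNSE1988]
* J. C. Robinson, J. L. Rodrigo, W. Sadowski, *The Three-Dimensional Navier–Stokes Equations*,
  CUP 2016, proof of Thm 7.1 ((7.3), `H^k` is an algebra, `k ≥ 2`). [RobinsonRodrigoSadowskiCUP2016]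
-/

noncomputable section

open _root_.MeasureTheory Set Filter Function
open scoped ENNReal NNReal InnerProductSpace ContDiff

namespace Literature.Analysis.FunctionSpaces

namespace Torus

variable {d : Type*} [Fintype d] [DecidableEq d]

/-! ### The directional bound, every dimension -/

/-- **`H¹` of one derivative of the linearised inertial term, every dimension.** For smooth
`v, w : T^d → ℝ^d` with `‖v‖ ≤ M`, `‖∂ₖv‖ ≤ L`, `‖w‖ ≤ N₀`, `‖∂ₖw‖ ≤ N₁` pointwise and every `m`,
`‖∇∂ₘ((v·∇)w + (w·∇)v)‖₂² ≤ 8dM² ∫ ‖Δ∂ₘw‖² + 16d²L² ‖∇∂ₘw‖₂² + 16d²N₁² ‖∇∂ₘv‖₂² + 8dN₀² ∫ ‖Δ∂ₘv‖²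
  + (8dL² ∫ ‖Δw‖² + 8dN₁² ∫ ‖Δv‖²)`:
Leibniz `∂ₘF = [(v·∇)∂ₘw + (∂ₘv·∇)w] + [(w·∇)∂ₘv + (∂ₘw·∇)v]` (`Torus.partialDeriv_convect_eq_add_convect`),
`‖∇(f + g)‖₂² ≤ 2‖∇f‖₂² + 2‖∇g‖₂²` three times, and the transport / stretching shapes
`Torus.gradNormSq_convect_le_of_norm_left_le` (for `(v·∇)∂ₘw`, `(w·∇)∂ₘv`) and
`Torus.gradNormSq_convect_le_of_norm_right_le` (for `(∂ₘv·∇)w`, `(∂ₘw·∇)v`): the sup norms always fall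
on a factor with at most one derivative. [folklore] -/
theorem gradNormSq_partialDeriv_convect_add_convect_le {v w : UnitAddTorus d → EuclideanSpace ℝ d}
    (hv : IsSmooth v) (hw : IsSmooth w) {M L N₀ N₁ : ℝ} (hM : ∀ x, ‖v x‖ ≤ M)
    (hL : ∀ (k : d) (x : UnitAddTorus d), ‖partialDeriv k v x‖ ≤ L) (hN₀ : ∀ x, ‖w x‖ ≤ N₀)
    (hN₁ : ∀ (k : d) (x : UnitAddTorus d), ‖partialDeriv k w x‖ ≤ N₁) (m : d) :
    gradNormSq (partialDeriv m (fun y => convect v w y + convect w v y)) ≤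
      8 * Fintype.card d * M ^ 2 * (∫ x, ‖laplacian (partialDeriv m w) x‖ ^ 2) +
        16 * Fintype.card d ^ 2 * L ^ 2 * gradNormSq (partialDeriv m w) +
        16 * Fintype.card d ^ 2 * N₁ ^ 2 * gradNormSq (partialDeriv m v) +
        8 * Fintype.card d * N₀ ^ 2 * (∫ x, ‖laplacian (partialDeriv m v) x‖ ^ 2) +
        (8 * Fintype.card d * L ^ 2 * (∫ x, ‖laplacian w x‖ ^ 2) +
          8 * Fintype.card d * N₁ ^ 2 * ∫ x, ‖laplacian v x‖ ^ 2) := by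
  have hF1 : IsSmooth (convect v w) := hv.convect hw
  have hF2 : IsSmooth (convect w v) := hw.convect hv
  have hDv : IsSmooth (partialDeriv m v) := hv.partialDeriv m
  have hDw : IsSmooth (partialDeriv m w) := hw.partialDeriv m
  -- Leibniz
  have hfun : partialDeriv m (fun y => convect v w y + convect w v y) =
      (convect v (partialDeriv m w) + convect (partialDeriv m v) w) +
        (convect w (partialDeriv m v) + convect (partialDeriv m w) v) := by
    rw [show (fun y => convect v w y + convect w v y) = convect v w + convect w v from rfl,
      partialDeriv_add (hF1.isContDiff (by simp)) (hF2.isContDiff (by simp)) m]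
    congr 1
    · funext x
      rw [Pi.add_apply]
      exact partialDeriv_convect_eq_add_convect hv hw m x
    · funext x
      rw [Pi.add_apply]
      exact partialDeriv_convect_eq_add_convect hw hv m x
  -- the four shapes and three splittings
  have hA := gradNormSq_convect_le_of_norm_left_le hv hDw hM hL
  have hB := gradNormSq_convect_le_of_norm_right_le hDv hw (hL m) hN₁
  have hC := gradNormSq_convect_le_of_norm_left_le hw hDv hN₀ hN₁
  have hD := gradNormSq_convect_le_of_norm_right_le hDw hv (hN₁ m) hL
  have hs1 := gradNormSq_add_le (hv.convect hDw) (hDv.convect hw)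
  have hs2 := gradNormSq_add_le (hw.convect hDv) (hDw.convect hv)
  have hs := gradNormSq_add_le ((hv.convect hDw).add (hDv.convect hw)) ((hw.convect hDv).add (hDw.convect hv))
  rw [hfun]
  linarith

/-! ### The estimate on `T³` -/

/-- **`‖Δ((v·∇)w + (w·∇)v)‖₂² ≤ C (M² + L² + ‖Δv‖₂² + ‖∇Δv‖₂²)(‖∇w‖₂² + ‖Δw‖₂² + ‖∇Δw‖₂²)` on `T³`**
(the bilinear term maps `D(A^{3/2}) × D(A^{3/2})` into `D(A)`, Constantin–Foias 1988 Ch. 6; the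
`H²`-level instance of "`H^k(T³)` is an algebra", Robinson–Rodrigo–Sadowski 2016, proof of Thm 7.1,
(7.3) with `k = 3` — here polarised, with the first factor measured in `W^{1,∞} ∩ H³` and the second,
zero-mean, in `H³`): on `T^d` with `card d = 3` there is `C ≥ 0` such that for all smooth
`v, w : T^d → ℝ^d` with `∫ w = 0`, `‖v‖ ≤ M` and `‖∂ₖv‖ ≤ L`,
`∫ ‖Δ((v·∇)w + (w·∇)v)‖² ≤ C (M² + L² + ∫ ‖Δv‖² + ‖∇Δv‖₂²)(‖∇w‖₂² + ∫ ‖Δw‖² + ‖∇Δw‖₂²)`.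
Proof: `∫ ‖ΔF‖² = ∑ₘ ‖∇∂ₘF‖₂²` (`Torus.sum_gradNormSq_partialDeriv_eq`), the directional bound
`gradNormSq_partialDeriv_convect_add_convect_le` with `N₀² = K(‖∇w‖₂² + ‖Δw‖₂²)`
(`Torus.norm_sq_le_gradNormSq_add_of_hasZeroMean`) and `N₁² = K'(‖Δw‖₂² + ‖∇Δw‖₂²)`
(`Torus.norm_partialDeriv_sq_le_of_isSmooth`), then `∑ₘ ‖Δ∂ₘ·‖₂² = ‖∇Δ·‖₂²`, `∑ₘ ‖∇∂ₘ·‖₂² = ‖Δ·‖₂²`;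
`C = 240 + 216K' + 24K`. [cite: RobinsonRodrigoSadowskiCUP2016, proof of Thm 7.1 (7.3)] -/
theorem integral_norm_laplacian_convect_add_convect_sq_le (hd : Fintype.card d = 3) :
    ∃ C : ℝ, 0 ≤ C ∧ ∀ {v w : UnitAddTorus d → EuclideanSpace ℝ d}, IsSmooth v → IsSmooth w → HasZeroMean w →
      ∀ {M L : ℝ}, (∀ x, ‖v x‖ ≤ M) → (∀ (k : d) (x : UnitAddTorus d), ‖partialDeriv k v x‖ ≤ L) →
        ∫ x, ‖laplacian (fun y => convect v w y + convect w v y) x‖ ^ 2 ≤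
          C * (M ^ 2 + L ^ 2 + (∫ x, ‖laplacian v x‖ ^ 2) + gradNormSq (laplacian v)) *
            (gradNormSq w + (∫ x, ‖laplacian w x‖ ^ 2) + gradNormSq (laplacian w)) := by
  obtain ⟨K, hK, hsup⟩ := norm_sq_le_gradNormSq_add_of_hasZeroMean (d := d) hd
  obtain ⟨K', hK', hsup'⟩ := norm_partialDeriv_sq_le_of_isSmooth (d := d) hd
  have hd3 : (Fintype.card d : ℝ) = 3 := by exact_mod_cast hd
  refine ⟨240 + 216 * K' + 24 * K, by positivity, fun {v w} hv hw h0 {M L} hM hL => ?_⟩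
  set G : ℝ := gradNormSq w with hG
  set Y : ℝ := ∫ x, ‖laplacian w x‖ ^ 2 with hY
  set Z : ℝ := gradNormSq (laplacian w) with hZ
  set Yv : ℝ := ∫ x, ‖laplacian v x‖ ^ 2 with hYv
  set Zv : ℝ := gradNormSq (laplacian v) with hZv
  have hG0 : 0 ≤ G := gradNormSq_nonneg _
  have hY0 : 0 ≤ Y := integral_nonneg fun x => sq_nonneg _
  have hZ0 : 0 ≤ Z := gradNormSq_nonneg _
  have hYv0 : 0 ≤ Yv := integral_nonneg fun x => sq_nonneg _
  have hZv0 : 0 ≤ Zv := gradNormSq_nonneg _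
  -- the sup bounds `‖w‖ ≤ N₀`, `‖∂ₖw‖ ≤ N₁`
  set N₀ : ℝ := Real.sqrt (K * (G + Y)) with hN₀
  have hN₀2 : N₀ ^ 2 = K * (G + Y) := Real.sq_sqrt (by positivity)
  have hN₀x : ∀ x, ‖w x‖ ≤ N₀ := fun x => by
    rw [hN₀, ← Real.sqrt_sq (norm_nonneg (w x))]
    exact Real.sqrt_le_sqrt (hsup w hw h0 x)
  set N₁ : ℝ := Real.sqrt (K' * (Y + Z)) with hN₁
  have hN₁2 : N₁ ^ 2 = K' * (Y + Z) := Real.sq_sqrt (by positivity)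
  have hN₁x : ∀ (k : d) (x : UnitAddTorus d), ‖partialDeriv k w x‖ ≤ N₁ := fun k x => by
    rw [hN₁, ← Real.sqrt_sq (norm_nonneg (partialDeriv k w x))]
    exact Real.sqrt_le_sqrt (hsup' w hw k x)
  have hF : IsSmooth (fun y => convect v w y + convect w v y) := (hv.convect hw).add (hw.convect hv)
  -- sum the directional bound over `m`
  have hsumZ : ∑ m, ∫ x, ‖laplacian (partialDeriv m w) x‖ ^ 2 = Z := (gradNormSq_laplacian_eq_sum hw).symm
  have hsumY : ∑ m, gradNormSq (partialDeriv m w) = Y := sum_gradNormSq_partialDeriv_eq hw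
  have hsumZv : ∑ m, ∫ x, ‖laplacian (partialDeriv m v) x‖ ^ 2 = Zv := (gradNormSq_laplacian_eq_sum hv).symm
  have hsumYv : ∑ m, gradNormSq (partialDeriv m v) = Yv := sum_gradNormSq_partialDeriv_eq hv
  have hsum : ∑ m, gradNormSq (partialDeriv m (fun y => convect v w y + convect w v y)) ≤
      8 * Fintype.card d * M ^ 2 * Z + 16 * Fintype.card d ^ 2 * L ^ 2 * Y +
        16 * Fintype.card d ^ 2 * N₁ ^ 2 * Yv + 8 * Fintype.card d * N₀ ^ 2 * Zv +
        Fintype.card d * (8 * Fintype.card d * L ^ 2 * Y + 8 * Fintype.card d * N₁ ^ 2 * Yv) := by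
    refine (Finset.sum_le_sum fun m _ =>
      gradNormSq_partialDeriv_convect_add_convect_le hv hw hM hL hN₀x hN₁x m).trans (le_of_eq ?_)
    simp only [Finset.sum_add_distrib, ← Finset.mul_sum, Finset.sum_const, Finset.card_univ, nsmul_eq_mul,
      hsumZ, hsumY, hsumZv, hsumYv]
    ring
  rw [← sum_gradNormSq_partialDeriv_eq hF]
  refine hsum.trans ?_
  rw [hN₀2, hN₁2, hd3]
  -- bookkeeping: every term is `≤ (const) · S · T`
  set S : ℝ := M ^ 2 + L ^ 2 + Yv + Zv with hS
  set T : ℝ := G + Y + Z with hT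
  have hM2 : M ^ 2 ≤ S := by rw [hS]; linarith [sq_nonneg L]
  have hL2 : L ^ 2 ≤ S := by rw [hS]; linarith [sq_nonneg M]
  have hYvS : Yv ≤ S := by rw [hS]; linarith [sq_nonneg M, sq_nonneg L]
  have hZvS : Zv ≤ S := by rw [hS]; linarith [sq_nonneg M, sq_nonneg L]
  have hS0 : 0 ≤ S := (sq_nonneg M).trans hM2
  have hZT : Z ≤ T := by rw [hT]; linarith
  have hYT : Y ≤ T := by rw [hT]; linarith
  have hYZT : Y + Z ≤ T := by rw [hT]; linarith
  have hGYT : G + Y ≤ T := by rw [hT]; linarith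
  have h1 : M ^ 2 * Z ≤ S * T := mul_le_mul hM2 hZT hZ0 hS0
  have h2 : L ^ 2 * Y ≤ S * T := mul_le_mul hL2 hYT hY0 hS0
  have h3 : K' * ((Y + Z) * Yv) ≤ K' * (T * S) :=
    mul_le_mul_of_nonneg_left (mul_le_mul hYZT hYvS hYv0 (hY0.trans hYT)) hK'.le
  have h4 : K * ((G + Y) * Zv) ≤ K * (T * S) :=
    mul_le_mul_of_nonneg_left (mul_le_mul hGYT hZvS hZv0 (hY0.trans hYT)) hK.le
  linarith

end Torus

end Literature.Analysis.FunctionSpaces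

end
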